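import Mathlib
import HarnessLib
import Summits.QuantumAdvantage.QuantumAdvantage.Theorems.PumpDialD

/-!
# PumpDial, part E (sections Classes, Staircase, Pieces, Node, NodeX) — support for item stmt-QuantumAdvantage-28487

Cell decomp-qadv, seat lens-4 («minimal counterexample / extremal reduction»), generation 25 — land port of the node
«PumpDial» (published under the cell's HOME/decomp-qadv-lens-4/g25/PumpDial.lean rev 3, sha256 59c460875773e61d…, record NODE-g25.md;
RESIDUAL MODE on AbsorptionDial:28487 `NoPerfectPolyOdd`).  The node file with ONLY the namespace renamed
`Theses.PumpDial → Theorems.PumpDial`, `example`s dropped and one-line docstrings added where missing, cut into chain-imported parts;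
the X-side junction theorems (conclusion `AbsorptionDial.NoPerfectPolyOdd` BY NAME) live in the LAST part, the only one importing
`Theses.AbsorptionDial`; every other part imports only `AdviceFreeQNC0.*`, `Literature.Computability.MetaComplexity.*`, HarnessLib, Mathlib
(no import path to any Theses file — checked on the tree's import lines), so route items can be typed BY NAME over these parts.
No `sorry`, no new axioms, no instances, no notation.

This part: `EvenOff` … `closes_B` (38 declarations).
-/

set_option autoImplicit false
set_option linter.dupNamespace false

noncomputable section

namespace Summit.QuantumAdvantage.QuantumAdvantage.Theorems.PumpDial
open Classical
open Finset
open Summit.QuantumAdvantage.AdviceFreeQNC0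
open Summit.QuantumAdvantage.AdviceFreeQNC0.TwoShot
open Summit.QuantumAdvantage.AdviceFreeQNC0.CharK
open Literature.Computability.MetaComplexity Literature.Computability.MetaComplexity.Smolensky

section Classes

variable {K : Type*} [Field K]

/-! ## §11 Board classes and the CLASS-TRANSFER law for the K-line -/


/-- the OTHER K-hard class: even boards OFF the diagonal (`c ≢ n`); on the two complementary classes (odd
off-diagonal, even diagonal) universal unities of degree `1`, `2` exist (DATA, g24 §3), so only these two classes can
carry the K-line. -/
def EvenOff (n c : ℕ) : Prop := n % 2 = 0 ∧ c % 3 ≠ n % 3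

/-- the K-hard class `= HardBoard ∪ EvenOff`; invariant under `n ↦ n + 6`. -/
def KHard (n c : ℕ) : Prop := HardBoard n c ∨ EvenOff n c

/-- `kHard_add_six` (PumpDial g25, section Classes). -/
theorem kHard_add_six {n c : ℕ} : KHard (n + 6) c ↔ KHard n c := by
  unfold KHard HardBoard EvenOff; omega

/-- `B_K` on the even class. -/
def NoUnityEvenAt (p : ℕ) [Fact p.Prime] : Prop :=
  ∀ C : ℕ, ∃ n₀ : ℕ, ∀ n ≥ n₀, ∀ c : ℕ, EvenOff n c → ¬ UnityAt (ZMod p) n c ((Nat.log 2 n) ^ C)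

/-- `B_K` on the even class, every prime `p ≥ 5` (equivalent to g24's `NoUnityHardOdd`: `noUnityHardOdd_iff_even`). -/
def NoUnityEvenOdd : Prop := ∀ (p : ℕ) [Fact p.Prime], 5 ≤ p → NoUnityEvenAt p


/-- CLIMB: a unity on an even off-diagonal board gives one on the odd DIAGONAL board one bit longer, one degree up
(charge duality supplies the partner charge, then gluing). -/
theorem climb_of_evenOff {m c d : ℕ} (hE : EvenOff m c) (hU : UnityAt K m c d) :
    ∃ c', HardBoard (m + 1) c' ∧ UnityAt K (m + 1) c' (d + 1) := by
  have h3 : c % 3 = (m + 1) % 3 ∨ c % 3 = (m + 2) % 3 := by have hc := hE.2; omega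
  have hm : m % 2 = 0 := hE.1
  rcases h3 with h | h
  · -- dual charge `≡ c + 1`; glue (dual at `c+1`, original at `c`) into `(m+1, c)`
    have hU' : UnityAt K m (c + 1) d := unityAt_cpl (by omega) hU
    exact ⟨c, ⟨by omega, by omega⟩, unityAt_glue hU' hU⟩
  · -- dual charge `e ≡ c + 2 ≡ m + 1`, and `c ≡ e + 1`; glue into `(m+1, e)`
    have hUe : UnityAt K m (c + 2) d := unityAt_cpl (by omega) hU
    have hU0 : UnityAt K m (c + 2 + 1) d := unityAt_charge_mod (by omega) hU
    exact ⟨c + 2, ⟨by omega, by omega⟩, unityAt_glue hU0 hUe⟩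

/-- DESCEND: a unity on an odd diagonal board `(m+1, c)` restricts to the even off-diagonal board `(m, c+1)` at the
SAME degree. -/
theorem descend_of_hard {m c d : ℕ} (hH : HardBoard (m + 1) c) (hU : UnityAt K (m + 1) c d) :
    EvenOff m (c + 1) ∧ UnityAt K m (c + 1) d :=
  ⟨⟨by have := hH.1; omega, by have := hH.2; omega⟩, (unityAt_restrict_diag' hH.2 hU).1⟩

/-- **CLASS-TRANSFER LAW (PROVED)**: for every prime `p`, `B_K` on odd diagonal boards ⟺ `B_K` on even off-diagonal
boards. -/
theorem noUnityHard_iff_even (p : ℕ) [Fact p.Prime] : NoUnityHardAt p ↔ NoUnityEvenAt p := by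
  constructor
  · intro hB C
    obtain ⟨n₀, h₀⟩ := hB (C + 1)
    refine ⟨max n₀ 4, fun n hn c hE hU => ?_⟩
    obtain ⟨c', hH, hU'⟩ := climb_of_evenOff hE hU
    have h4 : 4 ≤ n := le_trans (le_max_right _ _) hn
    exact h₀ (n + 1) (by have := le_max_left n₀ 4; omega) c' hH
      (unityAt_mono _ (pow_log_succ_le h4 (Nat.le_succ n)) hU')
  · intro hE C
    obtain ⟨n₀, h₀⟩ := hE (2 * C + 3)
    refine ⟨max (n₀ + 1) 16, fun n hn c hH hU => ?_⟩
    have h16 : 16 ≤ n := le_trans (le_max_right _ _) hn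
    obtain ⟨m, rfl⟩ : ∃ m, n = m + 1 := ⟨n - 1, by omega⟩
    obtain ⟨hE', hU'⟩ := descend_of_hard hH hU
    refine h₀ m (by have := le_max_left (n₀ + 1) 16; omega) (c + 1) hE' (unityAt_mono _ ?_ hU')
    have := polylog_bump (C := C) h16 le_rfl
    omega

/-- `noUnityHardOdd_iff_even` (PumpDial g25, section Classes). -/
theorem noUnityHardOdd_iff_even : NoUnityHardOdd ↔ NoUnityEvenOdd :=
  ⟨fun h p _ hp => (noUnityHard_iff_even p).1 (h p hp), fun h p _ hp => (noUnityHard_iff_even p).2 (h p hp)⟩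

end Classes

section Staircase

variable {K : Type*} [Field K]

/-! ## §12 THE STAIRCASE (PROVED inequalities for the least unity degree `D(n, c)`) -/

/-- `D_odd(m+1) ≥ D_even(m)`: no unity of degree `d` on `(m, c+1)` ⟹ none on the diagonal board `(m+1, c)`. -/
theorem stair_restrict {m c d : ℕ} (hc : c % 3 = (m + 1) % 3) (h : ¬ UnityAt K m (c + 1) d) :
    ¬ UnityAt K (m + 1) c d := fun hU => h (unityAt_restrict_diag' hc hU).1

/-- `D_even(m+2) ≥ D_even(m)` (and the same on odd off-diagonal boards): two-bit restriction. -/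
theorem stair_restrict_two {n c d : ℕ} (hc : c % 3 ≠ (n + 2) % 3) (h : ¬ UnityAt K n (c + 1) d) :
    ¬ UnityAt K (n + 2) c d := fun hU => by
  rcases (show c % 3 = (n + 1) % 3 ∨ c % 3 = n % 3 by omega) with h1 | h1
  · exact h (unityAt_restrict_two_A h1 hU)
  · exact h (unityAt_restrict_two_B h1 hU)

/-- `D_diag` is EVEN (`char K ≠ 2`): no unity of degree `2e` on a diagonal board ⟹ none of degree `2e+1`. -/
theorem stair_parity (h2 : (2 : K) ≠ 0) {n c e : ℕ} (hc : c % 3 = n % 3) (h : ¬ UnityAt K n c (2 * e)) :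
    ¬ UnityAt K n c (2 * e + 1) := fun hU => h (unityAt_parity_diag h2 hc hU)

/-- `D(m+1, c) ≤ max(D(m, c+1), D(m, c)) + 1`: gluing. -/
theorem stair_glue {m c d : ℕ} (h0 : UnityAt K m (c + 1) d) (h1 : UnityAt K m c d) :
    UnityAt K (m + 1) c (d + 1) := unityAt_glue h0 h1

/-- **FROM ONE COMPUTED BOARD TO ALL LARGER ONES (kernel)**: if `(14, 1)` carries no unity of degree `4` (exact
elimination, `g25/data/unity_fast.c`, over `𝔽₅, 𝔽₇, 𝔽₁₁`), then NO K-hard board of length `≥ 14` carries a unity of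
degree `4` … -/
theorem stair_from_14 (h14 : ¬ UnityAt K 14 1 4) :
    ∀ n c : ℕ, 14 ≤ n → KHard n c → ¬ UnityAt K n c 4 := by
  have hev : ∀ k c : ℕ, EvenOff (14 + 2 * k) c → ¬ UnityAt K (14 + 2 * k) c 4 := by
    intro k
    induction k with
    | zero =>
      intro c hE hU
      have hc : c % 3 = 0 ∨ c % 3 = 1 := by have := hE.2; omega
      rcases hc with hc | hc
      · exact h14 (unityAt_cpl (c'' := 1) (by omega) hU)
      · exact h14 (unityAt_charge_mod hc hU)
    | succ k ih =>
      intro c hE hU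
      rw [show 14 + 2 * (k + 1) = (14 + 2 * k) + 2 by ring] at hE hU
      have hc : c % 3 ≠ (14 + 2 * k + 2) % 3 := hE.2
      exact stair_restrict_two hc (ih (c + 1) ⟨by omega, by omega⟩) hU
  intro n c hn hK hU
  rcases hK with hH | hE
  · -- odd diagonal: `n = m + 1`, `m = 14 + 2k` even; descend.
    obtain ⟨k, rfl⟩ : ∃ k, n = (14 + 2 * k) + 1 := ⟨(n - 15) / 2, by have := hH.1; omega⟩
    obtain ⟨hE', hU'⟩ := descend_of_hard hH hU
    exact hev k (c + 1) hE' hU'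
  · obtain ⟨k, rfl⟩ : ∃ k, n = 14 + 2 * k := ⟨(n - 14) / 2, by have := hE.1; omega⟩
    exact hev k c hE hU

/-- … and (parity) no odd DIAGONAL board of length `≥ 15` carries one of degree `5`:
`D(n) ≥ 5` on even hard boards `n ≥ 14`, `D(n) ≥ 6` on odd hard boards `n ≥ 15`. -/
theorem stair_from_14_odd (h2 : (2 : K) ≠ 0) (h14 : ¬ UnityAt K 14 1 4) :
    ∀ n c : ℕ, 15 ≤ n → HardBoard n c → ¬ UnityAt K n c 5 := fun n c hn hH =>
  stair_parity (e := 2) h2 hH.2 (stair_from_14 h14 n c (by omega) (Or.inl hH))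

/-- the third residue: two distinct residues both different from `z` sum with `z` to `0 (mod 3)`
(`omega` alone does not find this). -/
private theorem third_residue {x y z : ℕ} (hxz : x % 3 ≠ z % 3) (hyz : y % 3 ≠ z % 3) (hxy : x % 3 ≠ y % 3) :
    (x + y + z) % 3 = 0 := by
  have hx : x % 3 < 3 := Nat.mod_lt _ (by norm_num)
  have hy : y % 3 < 3 := Nat.mod_lt _ (by norm_num)
  have hz : z % 3 < 3 := Nat.mod_lt _ (by norm_num)
  have key : (x % 3 + y % 3 + z % 3) % 3 = 0 := by
    generalize x % 3 = a at *
    generalize y % 3 = b at *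
    generalize z % 3 = c at *
    interval_cases a <;> interval_cases b <;> interval_cases c <;> omega
  omega

/-- **PROPAGATION LAW (monotonicity of the least unity degree along the K-hard class)**: ONE even off-diagonal
board `(m₀, c₀)` without a degree-`d` unity forces every K-hard board of length `≥ m₀` (both parities, every hard
charge) to have none — by duality on `m₀`, two-bit restriction up the even class, one-bit restriction to the odd class.
This is what makes single eliminations (census asks) kernel-meaningful for the whole tail. -/
theorem stair_from {m₀ c₀ d : ℕ} (hm : m₀ % 2 = 0) (hc₀ : c₀ % 3 ≠ m₀ % 3) (h0 : ¬ UnityAt K m₀ c₀ d) :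
    ∀ n c : ℕ, m₀ ≤ n → KHard n c → ¬ UnityAt K n c d := by
  have hev : ∀ k c : ℕ, EvenOff (m₀ + 2 * k) c → ¬ UnityAt K (m₀ + 2 * k) c d := by
    intro k
    induction k with
    | zero =>
      intro c hE hU
      simp only [Nat.mul_zero, Nat.add_zero] at hE hU
      by_cases hcc : c % 3 = c₀ % 3
      · exact h0 (unityAt_charge_mod hcc hU)
      · have h3 : (c + c₀ + m₀) % 3 = 0 := third_residue hE.2 hc₀ hcc
        exact h0 (unityAt_cpl h3 hU)
    | succ k ih =>
      intro c hE hU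
      rw [show m₀ + 2 * (k + 1) = (m₀ + 2 * k) + 2 by ring] at hE hU
      have hE1 : (m₀ + 2 * k) % 2 = 0 := by have := hE.1; omega
      have hE2 : (c + 1) % 3 ≠ (m₀ + 2 * k) % 3 := by have := hE.2; clear hE hU ih h0 hE1 hm hc₀; omega
      exact stair_restrict_two hE.2 (ih (c + 1) ⟨hE1, hE2⟩) hU
  intro n c hn hK hU
  rcases hK with hH | hE
  · obtain ⟨k, hk⟩ : ∃ k, n = (m₀ + 2 * k) + 1 := ⟨(n - m₀ - 1) / 2, by have := hH.1; omega⟩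
    subst hk
    obtain ⟨hE', hU'⟩ := descend_of_hard hH hU
    exact hev k (c + 1) hE' hU'
  · obtain ⟨k, hk⟩ : ∃ k, n = m₀ + 2 * k := ⟨(n - m₀) / 2, by have := hE.1; omega⟩
    subst hk
    exact hev k c hE hU

/-- propagation + parity: an even-degree gap on an even board becomes an odd-degree gap on the odd diagonal boards above. -/
theorem stair_from_odd (h2 : (2 : K) ≠ 0) {m₀ c₀ e : ℕ} (hm : m₀ % 2 = 0) (hc₀ : c₀ % 3 ≠ m₀ % 3)
    (h0 : ¬ UnityAt K m₀ c₀ (2 * e)) :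
    ∀ n c : ℕ, m₀ + 1 ≤ n → HardBoard n c → ¬ UnityAt K n c (2 * e + 1) := fun n c hn hH =>
  stair_parity h2 hH.2 (stair_from hm hc₀ h0 n c (by omega) (Or.inl hH))

/-- the census ask P1 of CENSUS-g25 in kernel form: «no degree-5 unity on (16, 0)» decides the degree-5 layer of the
whole tail (`D ≥ 6` on every K-hard board of length `≥ 16`). -/
theorem stair_from_16 (h16 : ¬ UnityAt K 16 0 5) : ∀ n c : ℕ, 16 ≤ n → KHard n c → ¬ UnityAt K n c 5 :=
  stair_from (by decide) (by decide) h16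

end Staircase

section Pieces


/-! ## §13 THE PIECES: base, pump, and the linear-degree ladder they generate -/

/-- **piece `BASE = UnityBase`** [support · FINITE (six boards `n = 4..9`, degree `0`): no CONSTANT unity on a
K-hard board of length `4 ≤ n ≤ 9` · PROVED IN THE KERNEL for every field and every K-hard board of length `≥ 2`
(§16 `noConstantUnity`, `unityBase_holds`; descent by the laws R/L3 to length 2) · INSTRUMENTED (degree-`0` layer
of every run in `g25/data`)]. -/
def UnityBaseAt (p : ℕ) [Fact p.Prime] : Prop :=
  ∀ n c : ℕ, 4 ≤ n → n ≤ 9 → KHard n c → ¬ UnityAt (ZMod p) n c 0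

/-- `BASE` for every prime `p ≥ 5` [support · PROVED: `unityBase_holds` (§16)]. -/
def UnityBase : Prop := ∀ (p : ℕ) [Fact p.Prime], 5 ≤ p → UnityBaseAt p

/-- **piece `PUMP = UnityPump`** [crux · UNDECIDED · the conjectural LAW behind the data: six more bits cost two more
degrees — `D(n+6, c) ≥ D(n, c) + 2` on K-hard boards (`n + 6` has the parity and the residue of `n`, so the class
is the same) · EXACT DATA: holds with equality for all six pairs `(4..9) → (10..15)` (`D = 2,2,2,2,3,4 ↦ 4,4,4,4,5,6`)
· INSTRUMENTABLE: first open instance `¬ UnityAt 𝔽₅ 16 0 6`? no — `D(16) ≥ D(10)+2 = 6`, i.e. «no degree-5 unity on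
(16, 0)» (census ask «pumpdial-v1») · ATTACKABLE: dual form = compose a degree-`d` DESIGN on `(n, c)` (g24
`designAt_iff_not_unityAt`) with a 6-bit gadget of strength 2 · X-INCOMPARABLE (K-valued)]. -/
def UnityPumpAt (p : ℕ) [Fact p.Prime] : Prop :=
  ∀ n c d : ℕ, 4 ≤ n → KHard n c → ¬ UnityAt (ZMod p) n c d → ¬ UnityAt (ZMod p) (n + 6) c (d + 2)

/-- `PUMP` for every prime `p ≥ 5` [crux · UNDECIDED · the one open piece of the K-line below `A_K`]. -/
def UnityPump : Prop := ∀ (p : ℕ) [Fact p.Prime], 5 ≤ p → UnityPumpAt p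

/-- **the LADDER statement `LUD = LinearUnityDegree`** [conjecture · slope `1/3`: no unity of degree
`2·⌊(n−4)/6⌋` on a K-hard board of length `n ≥ 4` · generated by `BASE ∧ PUMP` (`lud_of_base_pump`) · kernel +
one exact elimination give it up to `n = 21` (`stair_from_14`, `stair_from_14_odd`) · implies `B_K` on both classes
with a LINEAR margin over polylog (`noUnityHard_of_lud`)]. -/
def LinearUnityDegreeAt (p : ℕ) [Fact p.Prime] : Prop :=
  ∀ n c : ℕ, 4 ≤ n → KHard n c → ¬ UnityAt (ZMod p) n c (2 * ((n - 4) / 6))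

/-- `LUD` for every prime `p ≥ 5` [ladder statement · `BASE ∧ PUMP ⟹ LUD ⟹ B_K`]. -/
def LinearUnityDegree : Prop := ∀ (p : ℕ) [Fact p.Prime], 5 ≤ p → LinearUnityDegreeAt p

/-- **the SHARP conjectured law `THIRD = UnityThird`** [conjecture · the closed form fitted to the exact data
`D(4..15) = 2,2,2,2,3,4,4,4,4,4,5,6`: `D_even(m) = ⌊(m+2)/3⌋`, `D_odd(m) = 2⌈D_even(m−1)/2⌉`; typed as the lower bound
«no unity of degree `⌊(n + 2 − n % 2)/3⌋ − 1` on a K-hard board» · exact for every `n ≤ 15` · implies `LUD`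
(`lud_of_third`) · INSTRUMENTABLE: first instance beyond the kernel+elimination range is `n = 20`:
«no degree-6 unity on (20, off-diagonal)»]. -/
def UnityThirdAt (p : ℕ) [Fact p.Prime] : Prop :=
  ∀ n c : ℕ, 4 ≤ n → KHard n c → ¬ UnityAt (ZMod p) n c ((n + 2 - n % 2) / 3 - 1)

/-- `THIRD` for every prime `p ≥ 5` [conjecture · sharp form of `LUD`]. -/
def UnityThird : Prop := ∀ (p : ℕ) [Fact p.Prime], 5 ≤ p → UnityThirdAt p

/-- `lud_of_third` (PumpDial g25, section Pieces). -/
theorem lud_of_third {p : ℕ} [Fact p.Prime] (hT : UnityThirdAt p) : LinearUnityDegreeAt p :=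
  fun n c hn hK hU => hT n c hn hK (unityAt_mono _ (by omega) hU)

/-- `BASE ∧ PUMP ⟹ LUD` (induction on `n` in steps of six). -/
theorem lud_of_base_pump {p : ℕ} [Fact p.Prime] (hB : UnityBaseAt p) (hP : UnityPumpAt p) :
    LinearUnityDegreeAt p := by
  intro n
  induction n using Nat.strong_induction_on with
  | _ n ih =>
    intro c hn hK
    by_cases h9 : n ≤ 9
    · rw [show 2 * ((n - 4) / 6) = 0 by omega]
      exact hB n c hn h9 hK
    · obtain ⟨m, rfl⟩ : ∃ m, n = m + 6 := ⟨n - 6, by omega⟩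
      have hKm : KHard m c := kHard_add_six.1 hK
      have h := hP m c _ (by omega) hKm (ih m (by omega) c (by omega) hKm)
      rwa [show 2 * ((m + 6 - 4) / 6) = 2 * ((m - 4) / 6) + 2 by omega]

/-- linear beats polylog: `(log₂ n)^C ≤ 2·⌊(n−4)/6⌋` eventually (via the tree's `(log₂ n)^C ≤ √n`). -/
theorem polylog_le_third (C : ℕ) : ∃ n₀ : ℕ, ∀ n ≥ n₀, (Nat.log 2 n) ^ C ≤ 2 * ((n - 4) / 6) := by
  obtain ⟨n₀, h₀⟩ := TubePlanProof.logPow_le_natSqrt C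
  refine ⟨max n₀ 100, fun n hn => ?_⟩
  have h1 := h₀ n (le_trans (le_max_left _ _) hn)
  have h100 : 100 ≤ n := le_trans (le_max_right _ _) hn
  have hs : 10 ≤ Nat.sqrt n := Nat.le_sqrt.2 (by omega)
  have hss : Nat.sqrt n * Nat.sqrt n ≤ n := Nat.sqrt_le n
  have h10 : 10 * Nat.sqrt n ≤ n := le_trans (Nat.mul_le_mul_right _ hs) hss
  omega

/-- **`LUD ⟹ B_K` on the odd diagonal class** (and on the even class). -/
theorem noUnityHard_of_lud {p : ℕ} [Fact p.Prime] (hL : LinearUnityDegreeAt p) : NoUnityHardAt p := by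
  intro C
  obtain ⟨n₀, h₀⟩ := polylog_le_third C
  refine ⟨max n₀ 4, fun n hn c hH hU => ?_⟩
  exact hL n c (le_trans (le_max_right _ _) hn) (Or.inl hH)
    (unityAt_mono _ (h₀ n (le_trans (le_max_left _ _) hn)) hU)

/-- `noUnityEven_of_lud` (PumpDial g25, section Pieces). -/
theorem noUnityEven_of_lud {p : ℕ} [Fact p.Prime] (hL : LinearUnityDegreeAt p) : NoUnityEvenAt p := by
  intro C
  obtain ⟨n₀, h₀⟩ := polylog_le_third C
  refine ⟨max n₀ 4, fun n hn c hE hU => ?_⟩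
  exact hL n c (le_trans (le_max_right _ _) hn) (Or.inr hE)
    (unityAt_mono _ (h₀ n (le_trans (le_max_left _ _) hn)) hU)

end Pieces

section Node


/-! ## §14 THE NODE -/

/-- **DECIDING THEOREM of this node (K-level)**: `BASE → PUMP → B_K`, conclusion g24's crux `NoUnityHardOdd` BY NAME,
both binders used (`BASE` starts the induction, `PUMP` runs it; `LUD` is the induction's invariant; linear beats
polylog). -/
theorem closes_K (hBase : UnityBase) (hPump : UnityPump) : NoUnityHardOdd :=
  fun p _ hp => noUnityHard_of_lud (lud_of_base_pump (hBase p hp) (hPump p hp))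

/-- `closes_K_even` (PumpDial g25, section Node). -/
theorem closes_K_even (hBase : UnityBase) (hPump : UnityPump) : NoUnityEvenOdd :=
  fun p _ hp => noUnityEven_of_lud (lud_of_base_pump (hBase p hp) (hPump p hp))

/-- `lud_of_pieces` (PumpDial g25, section Node). -/
theorem lud_of_pieces (hBase : UnityBase) (hPump : UnityPump) : LinearUnityDegree :=
  fun p _ hp => lud_of_base_pump (hBase p hp) (hPump p hp)

/-- `closes_K_of_lud` (PumpDial g25, section Node). -/
theorem closes_K_of_lud (hL : LinearUnityDegree) : NoUnityHardOdd :=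
  fun p _ hp => noUnityHard_of_lud (hL p hp)

/-- `closes_K_of_third` (PumpDial g25, section Node). -/
theorem closes_K_of_third (hT : UnityThird) : NoUnityHardOdd :=
  fun p _ hp => noUnityHard_of_lud (lud_of_third (hT p hp))

end Node

section NodeX


/-- the Boolean, X-IMPLIED special case for free: `BASE → PUMP → B` (no one-live polylog strategy on large odd
diagonal boards; g24 `bK_imp_b`). -/
theorem closes_B (hBase : UnityBase) (hPump : UnityPump) : NoOneLiveHardOdd :=
  bK_imp_b (closes_K hBase hPump)

end NodeX

end Summit.QuantumAdvantage.QuantumAdvantage.Theorems.PumpDial
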